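import Summits.NavierStokesRegularity.FluidComputer.TubeTablePost18L
import HarnessLib

/-!
# Kernel run of the post-ramp box tube, chunks 6 … 11 (bp3 gen 16)

HONEST FRAMING: low prior, high value-of-information experiment on Tao's machine paradigm; NOT a
claim that NS blows up.

Kernel evaluations (`decide +kernel`; no `native_decide`, no extra axioms) of the in-tree tube checker
`runTube` (`P = 60`, 12 Taylor terms, cube `Rt`, read-out `CLt`) on the chunks `cPL 6 … cPL 11`
(= design chunks `cT 24 … cT 29`) of `TubeTablePost18L.lean`, each from the recorded boundary
state `sPL i` to `sPL (i+1)`.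

[cite: Tao2016AveragedNS, §5.5 Thm 5.3 (5.5)]
-/

namespace Summit.NavierStokesRegularity.FluidComputer

namespace TubeTablePost18L

open Literature.Analysis.FluidPDE.FluidComputer Literature.Analysis.FluidPDE.FluidComputer.TubeTable
open Literature.Analysis.FluidPDE.FluidComputer.ThresholdLevelTable (GIt)

set_option maxHeartbeats 10000000 in
set_option maxRecDepth 200000 in
/-- Chunk 6 of the post-ramp tube run (design chunk 24: 50 steps at `h = 2^-11`). [folklore] -/
theorem runPL_6 : runTube 60 12 GIt CLt Rt (sPL 6) (cPL 6) = some (sPL (6 + 1)) := by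
  decide +kernel

set_option maxHeartbeats 10000000 in
set_option maxRecDepth 200000 in
/-- Chunk 7 of the post-ramp tube run (design chunk 25: 50 steps at `h = 2^-11`). [folklore] -/
theorem runPL_7 : runTube 60 12 GIt CLt Rt (sPL 7) (cPL 7) = some (sPL (7 + 1)) := by
  decide +kernel

set_option maxHeartbeats 10000000 in
set_option maxRecDepth 200000 in
/-- Chunk 8 of the post-ramp tube run (design chunk 26: 50 steps at `h = 2^-11`). [folklore] -/
theorem runPL_8 : runTube 60 12 GIt CLt Rt (sPL 8) (cPL 8) = some (sPL (8 + 1)) := by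
  decide +kernel

set_option maxHeartbeats 10000000 in
set_option maxRecDepth 200000 in
/-- Chunk 9 of the post-ramp tube run (design chunk 27: 50 steps at `h = 2^-11`). [folklore] -/
theorem runPL_9 : runTube 60 12 GIt CLt Rt (sPL 9) (cPL 9) = some (sPL (9 + 1)) := by
  decide +kernel

set_option maxHeartbeats 10000000 in
set_option maxRecDepth 200000 in
/-- Chunk 10 of the post-ramp tube run (design chunk 28: 50 steps at `h = 2^-11`). [folklore] -/
theorem runPL_10 : runTube 60 12 GIt CLt Rt (sPL 10) (cPL 10) = some (sPL (10 + 1)) := by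
  decide +kernel

set_option maxHeartbeats 10000000 in
set_option maxRecDepth 200000 in
/-- Chunk 11 of the post-ramp tube run (design chunk 29: 50 steps at `h = 2^-11`). [folklore] -/
theorem runPL_11 : runTube 60 12 GIt CLt Rt (sPL 11) (cPL 11) = some (sPL (11 + 1)) := by
  decide +kernel

end TubeTablePost18L

end Summit.NavierStokesRegularity.FluidComputer
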